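import Mathlib.NumberTheory.Padics.PadicIntegers
import Mathlib.Algebra.Group.Subgroup.Pointwise
import Mathlib.GroupTheory.QuotientGroup.Basic
import HarnessLib

/-!
# Equivariant unramified descent of an exponent-`p` character from the top of a `ℤ_p`-tower to a
# finite layer (Washington §13.3, Lemmas 13.14–13.15, made Galois-equivariant; group-theoretic core)

Topic `NumberTheory/NumberFields` (namespace = path, grouping sub-namespace
`EquivariantUnramifiedDescent`).  THEOREM-ONLY file (no definition, no named fact, no `sorry`),
written by the literature seat `bsd-potss-conjA-anchor` g17 (cell `bsd-potss`; serves the asides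
stmt-BirchSwinnertonDyer-19386 `WildFineSelmerCoatesSujatha` / 19413 `TameFineSelmerCoatesSujatha`;
closes nothing; neither Coates–Sujatha's Conjecture A nor BSD is proved for any curve here).

## The situation (abstracted) and what is proved

Let `Γ` be a group (later: `Γ_k = Gal(k̄/k)` of a number field), `κ : Γ → ℤ_p` a homomorphism (a
`ℤ_p`-extension `k_∞/k`), `Λ₀ ⊴ Γ` a normal subgroup (`Gal(k̄/L)` for a finite Galois `L/k`, e.g.
`L = k(E[p])`), and write `H′ = Λ₀ ∩ ker κ` (`= Gal(k̄/L_∞)`, `L_∞ = L k_∞`) and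
`Λ_n = Λ₀ ∩ κ⁻¹(pⁿℤ_p)` (`= Gal(k̄/L k_n)`).  Let `V` be an abelian group killed by `p` on which `Γ`
acts with `Λ₀` acting trivially, and let `φ : H′ → V` be a homomorphism which is `Γ`-EQUIVARIANT,
`φ(gτg⁻¹) = g • φ(τ)`.  Finally let `(I_i)_{i ∈ ι}` be a family of subgroups of `Γ` («inertia groups»),
some of them marked `p`-adic, such that: the conjugates of a fixed `p`-adic `I_{i₀}` are `p`-adic members
of the family; every non-`p`-adic `I_i` lies in `ker κ` (a `ℤ_p`-extension is unramified outside `p`,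
Washington Prop. 13.2); at level `n` every `p`-adic `I_i` is «totally ramified»:
`κ(I_i ∩ Λ₀) ⊇ pⁿℤ_p`; and `φ` kills every `I_i ∩ H′` (`φ` is «unramified»).

* `exists_descentSubgroup` — ONE LAYER UP all the `p`-adic inertia groups die in a common normal
  complement: `Q = (I_{i₀} ∩ Λ_{n+1}) · ker φ` satisfies `Q ≤ Λ_{n+1}`, `gQg⁻¹ = Q`,
  **`I_i ∩ Λ_{n+1} ≤ Q` for EVERY `i`**, `Q ∩ H′ = ker φ` and `Λ_{n+1} = H′ · Q`.  This is the
  computation of Washington §13.3 (the elements `σ_i σ_1⁻¹` of Lemma 13.15 generating the inertia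
  differences) in the special case `p · (H′/ker φ) = 0`, where those differences are `p`-th powers in an
  exponent-`p` group, hence trivial: for `x ∈ I_i ∩ Λ_{n+1}`, `κ(x) = p·t` with `t ∈ pⁿℤ_p`, so
  `x ≡ yᵖ ≡ y₀ᵖ (mod ker φ)` for `y ∈ I_i ∩ Λ₀`, `y₀ ∈ I_{i₀} ∩ Λ₀` with `κ(y) = κ(y₀) = t` — the
  commutator and `p`-th-power corrections lie in `ker φ` because `Λ₀` acts trivially on `V` and `pV = 0`.
* `exists_hom_of_descentSubgroup` — from such a `Q`, `ψ(hq) := φ(h)` is a well-defined additive map on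
  `Λ_{n+1} = H′Q` EXTENDING `φ`, with kernel `Q` (so killing every `I_i ∩ Λ_{n+1}`), `Γ`-EQUIVARIANT.
The combination `exists_equivariant_unramified_extension`, the topological supplement (`Q` is open when
`Γ` is compact, `I_{i₀}`, `Λ_{n+1}`, `ker φ` are closed and `V` is finite) and the existence of a totally
ramified level `n` (Washington Lemma 13.3) are in the sequel `EquivariantUnramifiedDescentOpen.lean`.

USE (cell `bsd-potss`, door «L6 ⟹ (A)»; assembly NOT in this file, which is pure group theory): with
`k = ℚ`, `L = ℚ(E[p])`, `V = E[p]`, `κ` cyclotomic, `I_i` the inertia groups of the primes of `ℤ̄`, a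
non-zero `Γ_ℚ`-equivariant everywhere-unramified `φ : Gal(ℚ̄/L_∞) → E[p]` (restriction of a `Γ`-fixed
fine Selmer class over `ℚ_∞`) yields a non-zero `Γ_ℚ`-equivariant everywhere-unramified character of
`Gal(ℚ̄/L_{n+1})`, hence (equivariant Artin reciprocity) a non-zero equivariant `Cl(L_{n+1}) → E[p]`,
against `Hom_{Γ_ℚ}(Cl(L_{n+1}), E[p]) = 0` (`DeoRaySujatha2023.homTrivial_divisionField_cyclotomicTower`).
HONEST FRAMING: a lemma; the cites record the printed ARGUMENT transcribed (Washington §13.3), the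
equivariant exponent-`p` refinement being ours.

## References

* L. C. Washington, *Introduction to Cyclotomic Fields*, 2nd ed., GTM 83 (1997), §13.1 Prop. 13.2,
  Lemma 13.3; §13.3 Lemmas 13.14–13.15. [Washington1997]
* J. Coates, R. Sujatha, *Fine Selmer groups of elliptic curves over `p`-adic Lie extensions*,
  Math. Ann. 331 (2005), §3, Thm. 3.4 (the non-equivariant use of this descent: `μ(X(L_∞)) = 0 ⟹`
  Conjecture A). [CoatesSujatha2005]
-/

open scoped Pointwise

namespace Literature.NumberTheory.NumberFields

namespace EquivariantUnramifiedDescent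

section Algebra

variable {Γ : Type*} [Group Γ] {p : ℕ} [hp : Fact p.Prime]

/-- A homomorphism to the (abelian) group `ℤ_p` is constant on conjugacy classes. [folklore] -/
private theorem map_conj_eq (κ : Γ →* Multiplicative ℤ_[p]) (g x : Γ) : κ (g * x * g⁻¹) = κ x := by
  rw [map_mul, map_mul, map_inv, mul_comm (κ g) (κ x), mul_assoc, mul_inv_cancel, mul_one]

/-- An additive map on a subgroup sends `1` to `0`. [folklore] -/
private theorem map_one_eq_zero_of_mul {V : Type*} [AddCommGroup V] (H : Subgroup Γ) (φ : Γ → V)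
    (hφ : ∀ a ∈ H, ∀ b ∈ H, φ (a * b) = φ a + φ b) : φ 1 = 0 := by
  have h := hφ 1 H.one_mem 1 H.one_mem
  rw [mul_one] at h
  exact left_eq_add.mp h

/-- An additive map on a subgroup sends inverses to negatives. [folklore] -/
private theorem map_inv_eq_neg_of_mul {V : Type*} [AddCommGroup V] (H : Subgroup Γ) (φ : Γ → V)
    (hφ : ∀ a ∈ H, ∀ b ∈ H, φ (a * b) = φ a + φ b) {a : Γ} (ha : a ∈ H) : φ a⁻¹ = -φ a := by
  have h := hφ a⁻¹ (H.inv_mem ha) a ha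
  rw [inv_mul_cancel, map_one_eq_zero_of_mul H φ hφ] at h
  exact (neg_eq_of_add_eq_zero_left h.symm).symm

/-- An additive map on a subgroup sends `a ^ m` to `m • φ a`. [folklore] -/
private theorem map_pow_eq_nsmul_of_mul {V : Type*} [AddCommGroup V] (H : Subgroup Γ) (φ : Γ → V)
    (hφ : ∀ a ∈ H, ∀ b ∈ H, φ (a * b) = φ a + φ b) {a : Γ} (ha : a ∈ H) (m : ℕ) :
    φ (a ^ m) = m • φ a := by
  induction m with
  | zero => rw [pow_zero, zero_smul, map_one_eq_zero_of_mul H φ hφ]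
  | succ m ih => rw [pow_succ, hφ _ (H.pow_mem ha m) a ha, ih, succ_nsmul]

/-- The kernel `{x ∈ H′ : φ x = 0}` of an additive, `Γ`-equivariant map on a normal subgroup `H′` is a
normal subgroup of `Γ` (presented by its membership predicate). [folklore] -/
private theorem exists_kernelSubgroup {V : Type*} [AddCommGroup V] [DistribMulAction Γ V]
    (H : Subgroup Γ) (hHn : ∀ (g : Γ), ∀ x ∈ H, g * x * g⁻¹ ∈ H) (φ : Γ → V)
    (hφ : ∀ a ∈ H, ∀ b ∈ H, φ (a * b) = φ a + φ b)
    (hφ_equiv : ∀ (g : Γ), ∀ τ ∈ H, φ (g * τ * g⁻¹) = g • φ τ) :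
    ∃ K : Subgroup Γ, K.Normal ∧ ∀ x, x ∈ K ↔ x ∈ H ∧ φ x = 0 := by
  refine ⟨{ carrier := {x | x ∈ H ∧ φ x = 0}
            mul_mem' := fun {a b} ha hb => ⟨H.mul_mem ha.1 hb.1, by
              rw [hφ a ha.1 b hb.1, ha.2, hb.2, add_zero]⟩
            one_mem' := ⟨H.one_mem, map_one_eq_zero_of_mul H φ hφ⟩
            inv_mem' := fun {a} ha => ⟨H.inv_mem ha.1, by
              rw [map_inv_eq_neg_of_mul H φ hφ ha.1, ha.2, neg_zero]⟩ }, ⟨fun x hx g => ?_⟩,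
    fun x => Iff.rfl⟩
  exact ⟨hHn g x hx.1, by rw [hφ_equiv g x hx.1, hx.2, smul_zero]⟩

/-- **The descent subgroup** (Washington §13.3 with `p(H′/ker φ) = 0`, equivariant).  Notation of the
module docstring: `H′ = Λ₀ ∩ ker κ`, `Λ_m = Λ₀ ∩ κ⁻¹(pᵐℤ_p)` (both presented by their membership
predicates), `φ` additive and `Γ`-equivariant on `H′`, killing every `I_i ∩ H′`, `Λ₀` acting trivially on
the exponent-`p` module `V`, the non-`p`-adic `I_i` inside `ker κ`, the `p`-adic ones totally ramified at
level `n` (`κ(I_i ∩ Λ₀) ⊇ pⁿℤ_p`) and containing all conjugates of `I_{i₀}`.  THEN there is a subgroup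
`Q` of `Λ_{n+1}` — namely `Q = (I_{i₀} ∩ Λ_{n+1}) · ker φ` — normal in `Γ`, containing `I_i ∩ Λ_{n+1}` for
EVERY `i`, with `Q ∩ H′ = ker φ` and `Λ_{n+1} = H′ · Q`.
[cite: Washington1997, §13.3 Lemmas 13.14–13.15 (the inertia groups `I_i ≅ Γ` and the elements `σ_iσ_1⁻¹`), §13.1 Prop. 13.2] -/
theorem exists_descentSubgroup (κ : Γ →* Multiplicative ℤ_[p]) (Λ₀ : Subgroup Γ) [hΛ₀ : Λ₀.Normal]
    (H' : Subgroup Γ) (hH' : ∀ σ, σ ∈ H' ↔ σ ∈ Λ₀ ∧ κ σ = 1)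
    (Λ : ℕ → Subgroup Γ) (hΛ : ∀ m σ, σ ∈ Λ m ↔ σ ∈ Λ₀ ∧ (p : ℤ_[p]) ^ m ∣ (κ σ).toAdd)
    {V : Type*} [AddCommGroup V] [DistribMulAction Γ V]
    (hpV : ∀ v : V, p • v = 0) (htriv : ∀ σ ∈ Λ₀, ∀ v : V, σ • v = v)
    {ι : Type*} (I : ι → Subgroup Γ) (pAdic : ι → Prop) (i₀ : ι) (hi₀ : pAdic i₀)
    (hconj : ∀ g : Γ, ∃ j, pAdic j ∧ ∀ x, x ∈ I j ↔ g⁻¹ * x * g ∈ I i₀)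
    (hIker : ∀ i, ¬ pAdic i → ∀ x ∈ I i, κ x = 1)
    (n : ℕ)
    (hram : ∀ i, pAdic i → ∀ t : ℤ_[p], (p : ℤ_[p]) ^ n ∣ t →
      ∃ y ∈ I i, y ∈ Λ₀ ∧ (κ y).toAdd = t)
    (φ : Γ → V) (hφ_mul : ∀ a ∈ H', ∀ b ∈ H', φ (a * b) = φ a + φ b)
    (hφ_equiv : ∀ (g : Γ), ∀ τ ∈ H', φ (g * τ * g⁻¹) = g • φ τ)
    (hφ_I : ∀ i, ∀ τ ∈ I i, τ ∈ H' → φ τ = 0) :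
    ∃ Q : Subgroup Γ,
      (∀ x, x ∈ Q ↔ ∃ y ∈ I i₀, ∃ k ∈ H', y ∈ Λ (n + 1) ∧ φ k = 0 ∧ y * k = x) ∧
      Q ≤ Λ (n + 1) ∧
      (∀ (g : Γ), ∀ x ∈ Q, g * x * g⁻¹ ∈ Q) ∧
      (∀ i, ∀ x ∈ I i, x ∈ Λ (n + 1) → x ∈ Q) ∧
      (∀ x ∈ H', x ∈ Q ↔ φ x = 0) ∧
      (∀ σ ∈ Λ (n + 1), ∃ h ∈ H', ∃ q ∈ Q, h * q = σ) := by
  classical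
  -- ### bookkeeping
  have hκconj : ∀ g x : Γ, κ (g * x * g⁻¹) = κ x := map_conj_eq κ
  have hH'n : ∀ (g : Γ), ∀ x ∈ H', g * x * g⁻¹ ∈ H' := fun g x hx => by
    rw [hH'] at hx ⊢
    exact ⟨hΛ₀.conj_mem x hx.1 g, by rw [hκconj, hx.2]⟩
  have hΛn : ∀ (m : ℕ) (g : Γ), ∀ x ∈ Λ m, g * x * g⁻¹ ∈ Λ m := fun m g x hx => by
    rw [hΛ] at hx ⊢
    exact ⟨hΛ₀.conj_mem x hx.1 g, by rw [hκconj]; exact hx.2⟩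
  have hH'Λ : ∀ m, ∀ x ∈ H', x ∈ Λ m := fun m x hx => by
    rw [hH'] at hx
    rw [hΛ]
    exact ⟨hx.1, by rw [hx.2, toAdd_one]; exact dvd_zero _⟩
  have hΛ₀_of : ∀ m, ∀ x ∈ Λ m, x ∈ Λ₀ := fun m x hx => ((hΛ m x).1 hx).1
  have hmemH' : ∀ x, x ∈ Λ₀ → κ x = 1 → x ∈ H' := fun x h1 h2 => (hH' x).2 ⟨h1, h2⟩
  have hφ_inv : ∀ a ∈ H', φ a⁻¹ = -φ a := fun a ha => map_inv_eq_neg_of_mul H' φ hφ_mul ha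
  -- ### the kernel `K = {x ∈ H′ : φ x = 0}`, a normal subgroup of `Γ`
  obtain ⟨K, hKn, hK⟩ := exists_kernelSubgroup H' hH'n φ hφ_mul hφ_equiv
  haveI := hKn
  have hKH' : K ≤ H' := fun x hx => ((hK x).1 hx).1
  -- ### `J = I_{i₀} ∩ Λ_{n+1}` and `Q = J ⊔ K = J · K`
  set J : Subgroup Γ := I i₀ ⊓ Λ (n + 1) with hJ
  refine ⟨J ⊔ K, ?_⟩
  have hQmem : ∀ x, x ∈ J ⊔ K ↔ ∃ y ∈ J, ∃ k ∈ K, y * k = x := fun x => by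
    rw [← SetLike.mem_coe, Subgroup.mul_normal, Set.mem_mul]
    simp only [SetLike.mem_coe]
  have hQle : J ⊔ K ≤ Λ (n + 1) :=
    sup_le inf_le_right (hKH'.trans fun x hx => hH'Λ (n + 1) x hx)
  -- ### total ramification one layer up: `p^{n+1} ∣ t ⟹ t = κ(y^p)` with `y ∈ I_i ∩ Λ₀`, `κ y = t/p`
  have key : ∀ x ∈ Λ (n + 1),
      ∃ t : ℤ_[p], (p : ℤ_[p]) ^ n ∣ t ∧ (κ x).toAdd = (p : ℤ_[p]) * t := by
    intro x hxΛ
    obtain ⟨s, hs⟩ := ((hΛ (n + 1) x).1 hxΛ).2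
    exact ⟨(p : ℤ_[p]) ^ n * s, dvd_mul_right _ _, by rw [hs, pow_succ]; ring⟩
  have hpow : ∀ y : Γ, ∀ t : ℤ_[p], (κ y).toAdd = t → (κ (y ^ p)).toAdd = (p : ℤ_[p]) * t :=
    fun y t hy => by rw [map_pow, toAdd_pow, hy, nsmul_eq_mul]
  -- ### (QI): every `I_i ∩ Λ_{n+1}` lies in `Q`
  have hQI : ∀ i, ∀ x ∈ I i, x ∈ Λ (n + 1) → x ∈ J ⊔ K := by
    intro i x hxI hxΛ
    by_cases hi : pAdic i
    · obtain ⟨t, htn, htx⟩ := key x hxΛ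
      obtain ⟨y, hyI, hyΛ₀, hyt⟩ := hram i hi t htn
      obtain ⟨y₀, hy₀I, hy₀Λ₀, hy₀t⟩ := hram i₀ hi₀ t htn
      -- `κ (y^p) = κ x = κ (y₀^p)`
      have hyp : κ (y ^ p) = κ x := Multiplicative.toAdd.injective (by rw [hpow y t hyt, htx])
      have hy₀p : κ (y₀ ^ p) = κ x := Multiplicative.toAdd.injective (by rw [hpow y₀ t hy₀t, htx])
      have hxΛ₀ : x ∈ Λ₀ := hΛ₀_of _ x hxΛ
      -- `h = (y^p)⁻¹ x ∈ I_i ∩ H′`, so `φ h = 0`, `h ∈ K`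
      have hh : (y ^ p)⁻¹ * x ∈ K := by
        rw [hK]
        have hhH' : (y ^ p)⁻¹ * x ∈ H' := hmemH' _
          (Λ₀.mul_mem (Λ₀.inv_mem (Λ₀.pow_mem hyΛ₀ p)) hxΛ₀)
          (by rw [map_mul, map_inv, hyp, inv_mul_cancel])
        exact ⟨hhH', hφ_I i _ ((I i).mul_mem ((I i).inv_mem ((I i).pow_mem hyI p)) hxI) hhH'⟩
      -- `h' = y₀⁻¹ y ∈ H′`
      have hh'H' : y₀⁻¹ * y ∈ H' := hmemH' _ (Λ₀.mul_mem (Λ₀.inv_mem hy₀Λ₀) hyΛ₀)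
        (Multiplicative.toAdd.injective (by
          rw [map_mul, map_inv, toAdd_mul, toAdd_inv, hyt, hy₀t, neg_add_cancel, toAdd_one]))
      -- `y₀` and `h'` commute modulo `K` (`Λ₀` acts trivially on `V`)
      have hcommK : (y₀ * (y₀⁻¹ * y))⁻¹ * ((y₀⁻¹ * y) * y₀) ∈ K := by
        rw [hK]
        have e : (y₀ * (y₀⁻¹ * y))⁻¹ * ((y₀⁻¹ * y) * y₀) =
            (y₀⁻¹ * y)⁻¹ * (y₀⁻¹ * (y₀⁻¹ * y) * y₀⁻¹⁻¹) := by group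
        have h2 : y₀⁻¹ * (y₀⁻¹ * y) * y₀⁻¹⁻¹ ∈ H' := hH'n y₀⁻¹ _ hh'H'
        rw [e]
        refine ⟨H'.mul_mem (H'.inv_mem hh'H') h2, ?_⟩
        rw [hφ_mul _ (H'.inv_mem hh'H') _ h2, hφ_equiv y₀⁻¹ _ hh'H', hφ_inv _ hh'H',
          htriv y₀⁻¹ (Λ₀.inv_mem hy₀Λ₀), neg_add_cancel]
      have hcomm : Commute (QuotientGroup.mk y₀ : Γ ⧸ K) (QuotientGroup.mk (y₀⁻¹ * y)) := by
        change (QuotientGroup.mk y₀ : Γ ⧸ K) * QuotientGroup.mk (y₀⁻¹ * y) =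
          QuotientGroup.mk (y₀⁻¹ * y) * QuotientGroup.mk y₀
        rw [← QuotientGroup.mk_mul, ← QuotientGroup.mk_mul]
        exact QuotientGroup.eq.2 hcommK
      -- `h'^p ∈ K` (`pV = 0`)
      have hh'p : (y₀⁻¹ * y) ^ p ∈ K := by
        rw [hK]
        exact ⟨H'.pow_mem hh'H' p, by
          rw [map_pow_eq_nsmul_of_mul H' φ hφ_mul hh'H' p, hpV]⟩
      -- hence `y^p ≡ y₀^p (mod K)`
      have hyy₀ : (y₀ ^ p)⁻¹ * y ^ p ∈ K := by
        rw [← QuotientGroup.eq]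
        have ey : y = y₀ * (y₀⁻¹ * y) := by group
        conv_rhs => rw [ey]
        rw [QuotientGroup.mk_pow, QuotientGroup.mk_pow, QuotientGroup.mk_mul, hcomm.mul_pow,
          ← QuotientGroup.mk_pow K (y₀⁻¹ * y) p, (QuotientGroup.eq_one_iff _).2 hh'p, mul_one]
      -- and `x = y₀^p · k` with `k ∈ K`, `y₀^p ∈ J`
      rw [hQmem]
      refine ⟨y₀ ^ p, Subgroup.mem_inf.2 ⟨(I i₀).pow_mem hy₀I p, ?_⟩,
        (y₀ ^ p)⁻¹ * y ^ p * ((y ^ p)⁻¹ * x), K.mul_mem hyy₀ hh, by group⟩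
      exact (hΛ _ _).2 ⟨Λ₀.pow_mem hy₀Λ₀ p, by rw [hy₀p]; exact ((hΛ (n + 1) x).1 hxΛ).2⟩
    · -- non-`p`-adic: `I_i ≤ ker κ`, so `x ∈ H′ ∩ I_i`, `φ x = 0`
      have hxH' : x ∈ H' := hmemH' x (hΛ₀_of _ x hxΛ) (hIker i hi x hxI)
      exact Subgroup.mem_sup_right ((hK x).2 ⟨hxH', hφ_I i x hxI hxH'⟩)
  refine ⟨?_, hQle, ?_, hQI, ?_, ?_⟩
  · -- membership
    intro x
    rw [hQmem]
    constructor
    · rintro ⟨y, hy, k, hk, rfl⟩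
      exact ⟨y, (Subgroup.mem_inf.1 hy).1, k, hKH' hk, (Subgroup.mem_inf.1 hy).2, ((hK k).1 hk).2,
        rfl⟩
    · rintro ⟨y, hyI, k, hkH', hyΛ, hk0, rfl⟩
      exact ⟨y, Subgroup.mem_inf.2 ⟨hyI, hyΛ⟩, k, (hK k).2 ⟨hkH', hk0⟩, rfl⟩
  · -- normality in `Γ`
    intro g x hx
    obtain ⟨y, hy, k, hk, rfl⟩ := (hQmem x).1 hx
    have e : g * (y * k) * g⁻¹ = (g * y * g⁻¹) * (g * k * g⁻¹) := by group
    rw [e]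
    refine (J ⊔ K).mul_mem ?_ (Subgroup.mem_sup_right (hKn.conj_mem k hk g))
    obtain ⟨j, _, hjI⟩ := hconj g
    refine hQI j _ ((hjI _).2 ?_) (hΛn _ g y (Subgroup.mem_inf.1 hy).2)
    have e' : g⁻¹ * (g * y * g⁻¹) * g = y := by group
    rw [e']
    exact (Subgroup.mem_inf.1 hy).1
  · -- `Q ∩ H′ = ker φ`
    intro x hxH'
    constructor
    · intro hx
      obtain ⟨y, hy, k, hk, rfl⟩ := (hQmem _).1 hx
      have hkH' : k ∈ H' := hKH' hk
      have hyH' : y ∈ H' := by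
        have : y * k * k⁻¹ ∈ H' := H'.mul_mem hxH' (H'.inv_mem hkH')
        rwa [mul_inv_cancel_right] at this
      rw [hφ_mul y hyH' k hkH', hφ_I i₀ y (Subgroup.mem_inf.1 hy).1 hyH', ((hK k).1 hk).2,
        add_zero]
    · intro hx0
      exact Subgroup.mem_sup_right ((hK x).2 ⟨hxH', hx0⟩)
  · -- `Λ_{n+1} = H′ · Q` (total ramification at `i₀`, one layer up)
    intro σ hσ
    obtain ⟨hσΛ₀, hσdvd⟩ := (hΛ (n + 1) σ).1 hσ
    obtain ⟨y, hyI, hyΛ₀, hyt⟩ := hram i₀ hi₀ (κ σ).toAdd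
      ((pow_dvd_pow (p : ℤ_[p]) (Nat.le_succ n)).trans hσdvd)
    have hyσ : κ y = κ σ := Multiplicative.toAdd.injective hyt
    have hyΛ : y ∈ Λ (n + 1) := (hΛ (n + 1) y).2 ⟨hyΛ₀, by rw [hyσ]; exact hσdvd⟩
    refine ⟨σ * y⁻¹, hmemH' _ (Λ₀.mul_mem hσΛ₀ (Λ₀.inv_mem hyΛ₀))
      (by rw [map_mul, map_inv, hyσ, mul_inv_cancel]), y,
      Subgroup.mem_sup_left (Subgroup.mem_inf.2 ⟨hyI, hyΛ⟩), by group⟩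

/-- **The extended character.**  Let `H′ ≤ Λ′` be subgroups of `Γ` stable under conjugation, `Λ′`
acting trivially on `V`, `φ` additive and `Γ`-equivariant on `H′`, and `Q ≤ Λ′` a conjugation-stable
subgroup with `Λ′ = H′ · Q` and `H′ ∩ Q = {x ∈ H′ : φ x = 0}` (e.g. the descent subgroup of
`exists_descentSubgroup`).  Then `ψ(hq) := φ(h)` is a well-defined map `Γ → V` (set to `0` off `Λ′`)
which extends `φ`, is additive on `Λ′`, is `Γ`-equivariant on `Λ′`, and has kernel exactly `Q` in `Λ′`.
[cite: Washington1997, §13.3 Lemma 13.15 (the quotient `X/(νY) ≅ A`, read through a character)] -/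
theorem exists_hom_of_descentSubgroup {V : Type*} [AddCommGroup V] [DistribMulAction Γ V]
    (H' Λ' Q : Subgroup Γ) (hH'n : ∀ (g : Γ), ∀ x ∈ H', g * x * g⁻¹ ∈ H')
    (hΛ'n : ∀ (g : Γ), ∀ x ∈ Λ', g * x * g⁻¹ ∈ Λ') (hQn : ∀ (g : Γ), ∀ x ∈ Q, g * x * g⁻¹ ∈ Q)
    (hH'Λ' : H' ≤ Λ') (hQΛ' : Q ≤ Λ') (htriv : ∀ σ ∈ Λ', ∀ v : V, σ • v = v)
    (φ : Γ → V) (hφ_mul : ∀ a ∈ H', ∀ b ∈ H', φ (a * b) = φ a + φ b)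
    (hφ_equiv : ∀ (g : Γ), ∀ τ ∈ H', φ (g * τ * g⁻¹) = g • φ τ)
    (hHQ : ∀ x ∈ H', x ∈ Q ↔ φ x = 0) (hdec : ∀ σ ∈ Λ', ∃ h ∈ H', ∃ q ∈ Q, h * q = σ) :
    ∃ ψ : Γ → V,
      (∀ τ ∈ H', ψ τ = φ τ) ∧
      (∀ σ ∈ Λ', ∀ h ∈ H', ∀ q ∈ Q, h * q = σ → ψ σ = φ h) ∧
      (∀ a ∈ Λ', ∀ b ∈ Λ', ψ (a * b) = ψ a + ψ b) ∧
      (∀ (g : Γ), ∀ σ ∈ Λ', ψ (g * σ * g⁻¹) = g • ψ σ) ∧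
      (∀ σ ∈ Λ', ψ σ = 0 ↔ σ ∈ Q) ∧
      (∀ σ, σ ∉ Λ' → ψ σ = 0) := by
  classical
  have hφ_one : φ 1 = 0 := map_one_eq_zero_of_mul H' φ hφ_mul
  have hφ_inv : ∀ a ∈ H', φ a⁻¹ = -φ a := fun a ha => map_inv_eq_neg_of_mul H' φ hφ_mul ha
  -- the map
  let ψ : Γ → V := fun σ => if hσ : σ ∈ Λ' then φ (hdec σ hσ).choose else 0
  -- well-definedness
  have hwd : ∀ σ ∈ Λ', ∀ h ∈ H', ∀ q ∈ Q, h * q = σ → ψ σ = φ h := by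
    intro σ hσ h hh q hq hσeq
    obtain ⟨h₁H, q₁, hq₁, he₁⟩ := (hdec σ hσ).choose_spec
    set h₁ := (hdec σ hσ).choose with hh₁def
    have hψσ : ψ σ = φ h₁ := by simp only [ψ, dif_pos hσ, hh₁def]
    rw [hψσ]
    -- `h⁻¹ h₁ = q q₁⁻¹ ∈ H′ ∩ Q`
    have e : h⁻¹ * h₁ = q * q₁⁻¹ := by
      rw [inv_mul_eq_iff_eq_mul, ← mul_inv_eq_iff_eq_mul.2 (he₁.trans hσeq.symm).symm]
      group
    have hmem : h⁻¹ * h₁ ∈ H' := H'.mul_mem (H'.inv_mem hh) h₁H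
    have hmemQ : h⁻¹ * h₁ ∈ Q := by rw [e]; exact Q.mul_mem hq (Q.inv_mem hq₁)
    have h0 : φ (h⁻¹ * h₁) = 0 := (hHQ _ hmem).1 hmemQ
    have : h₁ = h * (h⁻¹ * h₁) := by group
    rw [this, hφ_mul h hh _ hmem, h0, add_zero]
  refine ⟨ψ, ?_, hwd, ?_, ?_, ?_, ?_⟩
  · -- extends `φ`
    intro τ hτ
    exact hwd τ (hH'Λ' hτ) τ hτ 1 Q.one_mem (mul_one τ)
  · -- additive on `Λ′`
    intro a ha b hb
    obtain ⟨h₁, hh₁, q₁, hq₁, rfl⟩ := hdec a ha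
    obtain ⟨h₂, hh₂, q₂, hq₂, rfl⟩ := hdec b hb
    have hq₁Λ : q₁ ∈ Λ' := hQΛ' hq₁
    have hc : q₁ * h₂ * q₁⁻¹ ∈ H' := hH'n q₁ h₂ hh₂
    have e : h₁ * q₁ * (h₂ * q₂) = (h₁ * (q₁ * h₂ * q₁⁻¹)) * (q₁ * q₂) := by group
    rw [hwd _ (Λ'.mul_mem ha hb) _ (H'.mul_mem hh₁ hc) _ (Q.mul_mem hq₁ hq₂) e.symm,
      hwd _ ha h₁ hh₁ q₁ hq₁ rfl, hwd _ hb h₂ hh₂ q₂ hq₂ rfl, hφ_mul h₁ hh₁ _ hc,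
      hφ_equiv q₁ h₂ hh₂, htriv q₁ hq₁Λ]
  · -- equivariant on `Λ′`
    intro g σ hσ
    obtain ⟨h, hh, q, hq, rfl⟩ := hdec σ hσ
    have e : g * (h * q) * g⁻¹ = (g * h * g⁻¹) * (g * q * g⁻¹) := by group
    rw [hwd _ (hΛ'n g _ hσ) _ (hH'n g h hh) _ (hQn g q hq) e.symm, hwd _ hσ h hh q hq rfl,
      hφ_equiv g h hh]
  · -- kernel on `Λ′`
    intro σ hσ
    obtain ⟨h, hh, q, hq, rfl⟩ := hdec σ hσ
    rw [hwd _ hσ h hh q hq rfl]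
    constructor
    · intro h0
      exact Q.mul_mem ((hHQ h hh).2 h0) hq
    · intro hmem
      have hhQ : h ∈ Q := by
        have : h * q * q⁻¹ ∈ Q := Q.mul_mem hmem (Q.inv_mem hq)
        rwa [mul_inv_cancel_right] at this
      exact (hHQ h hh).1 hhQ
  · -- off `Λ′`
    intro σ hσ
    simp only [ψ, dif_neg hσ]

end Algebra

end EquivariantUnramifiedDescent

end Literature.NumberTheory.NumberFields
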